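import Summits.Ventures.PercRepro.S1DisjointSumCircuitTools
import Summits.Ventures.PercRepro.SevenThreeQThree
import Summits.Ventures.PercRepro.PhiCredit
import Summits.Ventures.PercRepro.RankLevelSetO

/-!
# PercRepro — THE CIRCUIT-SUMMAND CONSUMER AT `(7, 4)`: EVERY CIRCUIT SUMMAND (p2, gen 28; SUBCLAIM-S1
§6.10 (xvii))

**C-025 at `(7, 4)` holds on `M ⊕ N` whenever `N` is a circuit of `s + 1 ≥ 3` elements and `M` has rank
`7 − s`** — nothing else on `M`. Three cases on the circuit size, each from `S1DisjointSumCircuitTools`: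
`#U ≤ N_M(r, 4) + (s + 1) N_M(r, 3)` with the slices of `#Y` that matter.
* triangle (`s = 2`, `r = 5`): `#Y ≥ 4 f_M(5) + 7 f_M(4)`; `N_M(5, 4) ≤ f_M(5)` and the tree cell `(5, 3)`
  (`SevenThree.c025_three_all M 5`, `Φ = 5/4`) give `Φ(7, 4) · #U ≤ 2.8 f_M(5) + 6.72 f_M(4)`;
* `4`-circuit (`s = 3`, `r = 4`): `#Y ≥ 10 f_M(4) + 11 f_M(3)`; `N_M(4, 4) + N_M(4, 3) ≤ f_M(4)` and the
  complementation `N_M(4, 3) ≤ f_M(3)` give `Φ(7, 4) · #U ≤ 2.8 f_M(4) + 8.4 f_M(3)`;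
* circuits of `s + 1 ≥ 5` elements (`r ≤ 3`): `#U ≤ (s + 1) f_M(r)`, `#Y ≥ f_M(r) (C(s+1, s−2) + C(s+1, s−1))`
  and `14 (s + 1) ≤ 5 (C(s+1, s−2) + C(s+1, s−1))` for `4 ≤ s ≤ 7`.
Nothing else is claimed about any cell (the cell `(7, 4)` itself stays open).

* `ncard_Y_seven_four_triangle_ge`, `ncard_Y_seven_four_circuit_four_ge`, `ncard_Y_seven_four_large_ge` — the
  `Y`-sides; `binomial_sum_seven_four` — the numeric inequality;
* `c025_seven_four_disjointSum_triangle`, `c025_seven_four_disjointSum_circuit_four`,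
  `c025_seven_four_disjointSum_circuit_large` — the three consumers;
* **`c025_seven_four_disjointSum_circuit`** — every circuit summand.
Axioms: standard.
-/

open scoped Matroid

namespace PercRepro

namespace S1

open Set

variable {α : Type}

/-- The `Y`-side at `(7, 4)`, triangle summand: `#Y ≥ 4 f_M(5) + 7 f_M(4)`. -/
theorem ncard_Y_seven_four_triangle_ge (M N : Matroid α) [M.Finite] [N.Finite] (h : Disjoint M.E N.E)
    (hN : N.IsCircuit N.E) (hN3 : N.E.ncard = 3) :
    4 * (rankSet M 5).ncard + 7 * (rankSet M 4).ncard ≤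
      {A : Set α | A ⊆ (M.disjointSum N h).E ∧ ((4 : ℕ) : ℕ∞) < (M.disjointSum N h).eRk A ∧
        (M.disjointSum N h).eRk A < ((7 : ℕ) : ℕ∞)}.ncard := by
  have hN3' : N.E.ncard = 2 + 1 := hN3
  rw [disjointSum_ncard_Y_eq_finsum M N h 7 4, finsum_mem_coe_finset]
  have hsub : ({(5, 0), (5, 1), (4, 1), (4, 2)} : Finset (ℕ × ℕ)) ⊆
      (Finset.range 7 ×ˢ Finset.range 7).filter (fun x : ℕ × ℕ => 4 < x.1 + x.2 ∧ x.1 + x.2 < 7) := by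
    decide
  refine le_trans ?_ (Finset.sum_le_sum_of_subset hsub)
  rw [Finset.sum_insert (by decide), Finset.sum_insert (by decide), Finset.sum_insert (by decide),
    Finset.sum_singleton]
  dsimp only
  have f0 : 1 ≤ (rankSet N 0).ncard := by
    have := choose_le_ncard_rankSet_of_isCircuit_ground hN hN3' (a := 0) (by norm_num)
    rwa [Nat.choose_zero_right] at this
  have f1 : 3 ≤ (rankSet N 1).ncard := by
    have := choose_le_ncard_rankSet_of_isCircuit_ground hN hN3' (a := 1) (by norm_num)
    rwa [Nat.choose_one_right] at this
  have f2 : 4 ≤ (rankSet N 2).ncard := ncard_rankSet_top_of_isCircuit_ground hN hN3'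
  have e50 := Nat.mul_le_mul_left (rankSet M 5).ncard f0
  have e51 := Nat.mul_le_mul_left (rankSet M 5).ncard f1
  have e41 := Nat.mul_le_mul_left (rankSet M 4).ncard f1
  have e42 := Nat.mul_le_mul_left (rankSet M 4).ncard f2
  linarith

/-- The `Y`-side at `(7, 4)`, `4`-circuit summand: `#Y ≥ 10 f_M(4) + 11 f_M(3)`. -/
theorem ncard_Y_seven_four_circuit_four_ge (M N : Matroid α) [M.Finite] [N.Finite] (h : Disjoint M.E N.E)
    (hN : N.IsCircuit N.E) (hN4 : N.E.ncard = 4) :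
    10 * (rankSet M 4).ncard + 11 * (rankSet M 3).ncard ≤
      {A : Set α | A ⊆ (M.disjointSum N h).E ∧ ((4 : ℕ) : ℕ∞) < (M.disjointSum N h).eRk A ∧
        (M.disjointSum N h).eRk A < ((7 : ℕ) : ℕ∞)}.ncard := by
  have hN4' : N.E.ncard = 3 + 1 := hN4
  rw [disjointSum_ncard_Y_eq_finsum M N h 7 4, finsum_mem_coe_finset]
  have hsub : ({(4, 1), (4, 2), (3, 2), (3, 3)} : Finset (ℕ × ℕ)) ⊆
      (Finset.range 7 ×ˢ Finset.range 7).filter (fun x : ℕ × ℕ => 4 < x.1 + x.2 ∧ x.1 + x.2 < 7) := by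
    decide
  refine le_trans ?_ (Finset.sum_le_sum_of_subset hsub)
  rw [Finset.sum_insert (by decide), Finset.sum_insert (by decide), Finset.sum_insert (by decide),
    Finset.sum_singleton]
  dsimp only
  have f1 : 4 ≤ (rankSet N 1).ncard := by
    have := choose_le_ncard_rankSet_of_isCircuit_ground hN hN4' (a := 1) (by norm_num)
    rwa [Nat.choose_one_right] at this
  have f2 : 6 ≤ (rankSet N 2).ncard := by
    have := choose_le_ncard_rankSet_of_isCircuit_ground hN hN4' (a := 2) (by norm_num)
    rwa [show Nat.choose (3 + 1) 2 = 6 by decide] at this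
  have f3 : 5 ≤ (rankSet N 3).ncard := ncard_rankSet_top_of_isCircuit_ground hN hN4'
  have e41 := Nat.mul_le_mul_left (rankSet M 4).ncard f1
  have e42 := Nat.mul_le_mul_left (rankSet M 4).ncard f2
  have e32 := Nat.mul_le_mul_left (rankSet M 3).ncard f2
  have e33 := Nat.mul_le_mul_left (rankSet M 3).ncard f3
  linarith

/-- The `Y`-side at `(7, 4)`, circuit of `s + 1 ≥ 5` elements, `r + s = 7`:
`#Y ≥ f_M(r) · (C(s+1, s−2) + C(s+1, s−1))`. -/
theorem ncard_Y_seven_four_large_ge (M N : Matroid α) [M.Finite] [N.Finite] (h : Disjoint M.E N.E)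
    {r s : ℕ} (hrs : r + s = 7) (hs : 4 ≤ s) (hN : N.IsCircuit N.E) (hNs : N.E.ncard = s + 1) :
    (rankSet M r).ncard * (Nat.choose (s + 1) (s - 2) + Nat.choose (s + 1) (s - 1)) ≤
      {A : Set α | A ⊆ (M.disjointSum N h).E ∧ ((4 : ℕ) : ℕ∞) < (M.disjointSum N h).eRk A ∧
        (M.disjointSum N h).eRk A < ((7 : ℕ) : ℕ∞)}.ncard := by
  rw [disjointSum_ncard_Y_eq_finsum M N h 7 4, finsum_mem_coe_finset]
  have hsub : ({(r, s - 2), (r, s - 1)} : Finset (ℕ × ℕ)) ⊆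
      (Finset.range 7 ×ˢ Finset.range 7).filter (fun x : ℕ × ℕ => 4 < x.1 + x.2 ∧ x.1 + x.2 < 7) := by
    intro x hx
    simp only [Finset.mem_insert, Finset.mem_singleton] at hx
    simp only [Finset.mem_filter, Finset.mem_product, Finset.mem_range]
    rcases hx with rfl | rfl <;> (dsimp only; omega)
  refine le_trans ?_ (Finset.sum_le_sum_of_subset hsub)
  rw [Finset.sum_insert (by simp only [Finset.mem_singleton, Prod.mk.injEq]; omega), Finset.sum_singleton]
  dsimp only
  have f2 := choose_le_ncard_rankSet_of_isCircuit_ground hN hNs (a := s - 2) (by omega)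
  have f1 := choose_le_ncard_rankSet_of_isCircuit_ground hN hNs (a := s - 1) (by omega)
  have e2 := Nat.mul_le_mul_left (rankSet M r).ncard f2
  have e1 := Nat.mul_le_mul_left (rankSet M r).ncard f1
  linarith

/-- `14 (s + 1) ≤ 5 (C(s+1, s−2) + C(s+1, s−1))` for `4 ≤ s ≤ 7`. -/
theorem binomial_sum_seven_four {s : ℕ} (hs : 4 ≤ s) (hs7 : s ≤ 7) :
    14 * (s + 1) ≤ 5 * (Nat.choose (s + 1) (s - 2) + Nat.choose (s + 1) (s - 1)) := by
  interval_cases s <;> decide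

/-- The arithmetic of the triangle consumer at `(7, 4)`. -/
theorem consumer_arith_seven_four_triangle {u y P4 P3 f4 f5 : ℚ} (hU : u ≤ P4 + 3 * P3) (hP4 : P4 ≤ f5)
    (h53 : 5 / 4 * P3 ≤ f4) (hY : 4 * f5 + 7 * f4 ≤ y) (hf4 : 0 ≤ f4) (hf5 : 0 ≤ f5) :
    14 / 5 * u ≤ y := by
  linarith

/-- The arithmetic of the `4`-circuit consumer at `(7, 4)`. -/
theorem consumer_arith_seven_four_circuit_four {u y P4 P3 f4 f3 : ℚ} (hU : u ≤ P4 + 4 * P3)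
    (hsum : P4 + P3 ≤ f4) (hP3 : P3 ≤ f3) (hY : 10 * f4 + 11 * f3 ≤ y) (hf4 : 0 ≤ f4) (hf3 : 0 ≤ f3) :
    14 / 5 * u ≤ y := by
  linarith

/-- The arithmetic of the large-circuit consumer at `(7, 4)`: `14 u ≤ 5 y` gives `(14/5) u ≤ y`. -/
theorem consumer_arith_seven_four_large {u y : ℚ} (h : 14 * u ≤ 5 * y) : 14 / 5 * u ≤ y := by
  linarith

/-- **The triangle consumer at `(7, 4)`**: `M` of rank `5`, `N` a `3`-circuit — from the tree cell `(5, 3)`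
alone. -/
theorem c025_seven_four_disjointSum_triangle (M N : Matroid α) [M.Finite] [N.Finite]
    (h : Disjoint M.E N.E) (hM : M.eRank = ((5 : ℕ) : ℕ∞)) (hN : N.IsCircuit N.E) (hN3 : N.E.ncard = 3) :
    phiK 7 4 * ({A : Set α | A ⊆ (M.disjointSum N h).E ∧ (M.disjointSum N h).eRk A = ((7 : ℕ) : ℕ∞) ∧
        (M.disjointSum N h).eRk ((M.disjointSum N h).E \ A) = ((4 : ℕ) : ℕ∞)}.ncard : ℚ) ≤
      ({A : Set α | A ⊆ (M.disjointSum N h).E ∧ ((4 : ℕ) : ℕ∞) < (M.disjointSum N h).eRk A ∧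
        (M.disjointSum N h).eRk A < ((7 : ℕ) : ℕ∞)}.ncard : ℚ) := by
  have hU := ncard_U_disjointSum_circuit_le M N h (p := 7) (r := 5) (s := 2) rfl (by norm_num) hM hN hN3
  have hY := ncard_Y_seven_four_triangle_ge M N h hN hN3
  have hP4 := ncard_le_ncard (profileSet_subset_rankSet M 5 4) (rankSet_finite M 5)
  have h53 : (5 / 4 : ℚ) * ((profileSet M 5 3).ncard : ℚ) ≤ ((rankSet M 4).ncard : ℚ) := by
    have h0 := SevenThree.c025_three_all M 5 (by norm_num)
    unfold ThmN.RLS at h0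
    rw [ThmO.phiK_five_three, ySet_eq_rankSet_of_eq M (q := 3) (p := 5) (k := 4) rfl rfl] at h0
    exact h0
  rw [phiK_seven_four]
  have hU' : (({A : Set α | A ⊆ (M.disjointSum N h).E ∧ (M.disjointSum N h).eRk A = ((7 : ℕ) : ℕ∞) ∧
      (M.disjointSum N h).eRk ((M.disjointSum N h).E \ A) = ((4 : ℕ) : ℕ∞)}.ncard : ℕ) : ℚ) ≤
      ((profileSet M 5 4).ncard : ℚ) + 3 * ((profileSet M 5 3).ncard : ℚ) := by
    have hU2 : ({A : Set α | A ⊆ (M.disjointSum N h).E ∧ (M.disjointSum N h).eRk A = ((7 : ℕ) : ℕ∞) ∧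
        (M.disjointSum N h).eRk ((M.disjointSum N h).E \ A) = ((4 : ℕ) : ℕ∞)}.ncard : ℕ) ≤
        (profileSet M 5 4).ncard + 3 * (profileSet M 5 3).ncard := hU
    exact_mod_cast hU2
  have hY' : 4 * ((rankSet M 5).ncard : ℚ) + 7 * ((rankSet M 4).ncard : ℚ) ≤
      (({A : Set α | A ⊆ (M.disjointSum N h).E ∧ ((4 : ℕ) : ℕ∞) < (M.disjointSum N h).eRk A ∧
        (M.disjointSum N h).eRk A < ((7 : ℕ) : ℕ∞)}.ncard : ℕ) : ℚ) := by
    exact_mod_cast hY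
  have hP4' : ((profileSet M 5 4).ncard : ℚ) ≤ ((rankSet M 5).ncard : ℚ) := by exact_mod_cast hP4
  have hf4 : (0 : ℚ) ≤ ((rankSet M 4).ncard : ℚ) := Nat.cast_nonneg _
  have hf5 : (0 : ℚ) ≤ ((rankSet M 5).ncard : ℚ) := Nat.cast_nonneg _
  exact consumer_arith_seven_four_triangle hU' hP4' h53 hY' hf4 hf5

/-- **The `4`-circuit consumer at `(7, 4)`**: `M` of rank `4`, `N` a `4`-circuit — by counting alone. -/
theorem c025_seven_four_disjointSum_circuit_four (M N : Matroid α) [M.Finite] [N.Finite]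
    (h : Disjoint M.E N.E) (hM : M.eRank = ((4 : ℕ) : ℕ∞)) (hN : N.IsCircuit N.E) (hN4 : N.E.ncard = 4) :
    phiK 7 4 * ({A : Set α | A ⊆ (M.disjointSum N h).E ∧ (M.disjointSum N h).eRk A = ((7 : ℕ) : ℕ∞) ∧
        (M.disjointSum N h).eRk ((M.disjointSum N h).E \ A) = ((4 : ℕ) : ℕ∞)}.ncard : ℚ) ≤
      ({A : Set α | A ⊆ (M.disjointSum N h).E ∧ ((4 : ℕ) : ℕ∞) < (M.disjointSum N h).eRk A ∧
        (M.disjointSum N h).eRk A < ((7 : ℕ) : ℕ∞)}.ncard : ℚ) := by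
  have hU := ncard_U_disjointSum_circuit_le M N h (p := 7) (r := 4) (s := 3) rfl (by norm_num) hM hN hN4
  have hY := ncard_Y_seven_four_circuit_four_ge M N h hN hN4
  have hsum := ncard_profileSet_add_le_ncard_rankSet M 4 (b := 4) (b' := 3) (by norm_num)
  have hP3 := ncard_profileSet_le_ncard_rankSet_snd M 4 3
  rw [phiK_seven_four]
  have hU' : (({A : Set α | A ⊆ (M.disjointSum N h).E ∧ (M.disjointSum N h).eRk A = ((7 : ℕ) : ℕ∞) ∧
      (M.disjointSum N h).eRk ((M.disjointSum N h).E \ A) = ((4 : ℕ) : ℕ∞)}.ncard : ℕ) : ℚ) ≤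
      ((profileSet M 4 4).ncard : ℚ) + 4 * ((profileSet M 4 3).ncard : ℚ) := by
    have hU2 : ({A : Set α | A ⊆ (M.disjointSum N h).E ∧ (M.disjointSum N h).eRk A = ((7 : ℕ) : ℕ∞) ∧
        (M.disjointSum N h).eRk ((M.disjointSum N h).E \ A) = ((4 : ℕ) : ℕ∞)}.ncard : ℕ) ≤
        (profileSet M 4 4).ncard + 4 * (profileSet M 4 3).ncard := hU
    exact_mod_cast hU2
  have hY' : 10 * ((rankSet M 4).ncard : ℚ) + 11 * ((rankSet M 3).ncard : ℚ) ≤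
      (({A : Set α | A ⊆ (M.disjointSum N h).E ∧ ((4 : ℕ) : ℕ∞) < (M.disjointSum N h).eRk A ∧
        (M.disjointSum N h).eRk A < ((7 : ℕ) : ℕ∞)}.ncard : ℕ) : ℚ) := by
    exact_mod_cast hY
  have hsum' : ((profileSet M 4 4).ncard : ℚ) + ((profileSet M 4 3).ncard : ℚ) ≤ ((rankSet M 4).ncard : ℚ) := by
    exact_mod_cast hsum
  have hP3' : ((profileSet M 4 3).ncard : ℚ) ≤ ((rankSet M 3).ncard : ℚ) := by exact_mod_cast hP3
  have hf4 : (0 : ℚ) ≤ ((rankSet M 4).ncard : ℚ) := Nat.cast_nonneg _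
  have hf3 : (0 : ℚ) ≤ ((rankSet M 3).ncard : ℚ) := Nat.cast_nonneg _
  exact consumer_arith_seven_four_circuit_four hU' hsum' hP3' hY' hf4 hf3

/-- **The large-circuit consumer at `(7, 4)`**: `N` a circuit of `s + 1 ≥ 5` elements, `M` of rank
`r = 7 − s`. -/
theorem c025_seven_four_disjointSum_circuit_large (M N : Matroid α) [M.Finite] [N.Finite]
    (h : Disjoint M.E N.E) {r s : ℕ} (hrs : r + s = 7) (hs : 4 ≤ s) (hM : M.eRank = r)
    (hN : N.IsCircuit N.E) (hNs : N.E.ncard = s + 1) :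
    phiK 7 4 * ({A : Set α | A ⊆ (M.disjointSum N h).E ∧ (M.disjointSum N h).eRk A = ((7 : ℕ) : ℕ∞) ∧
        (M.disjointSum N h).eRk ((M.disjointSum N h).E \ A) = ((4 : ℕ) : ℕ∞)}.ncard : ℚ) ≤
      ({A : Set α | A ⊆ (M.disjointSum N h).E ∧ ((4 : ℕ) : ℕ∞) < (M.disjointSum N h).eRk A ∧
        (M.disjointSum N h).eRk A < ((7 : ℕ) : ℕ∞)}.ncard : ℚ) := by
  have hU := ncard_U_disjointSum_circuit_le M N h hrs (by omega) hM hN hNs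
  have hY := ncard_Y_seven_four_large_ge M N h hrs hs hN hNs
  have hb := binomial_sum_seven_four hs (by omega)
  have hsum := ncard_profileSet_add_le_ncard_rankSet M r (b := 4) (b' := 3) (by norm_num)
  have hkey : 14 * {A : Set α | A ⊆ (M.disjointSum N h).E ∧ (M.disjointSum N h).eRk A = ((7 : ℕ) : ℕ∞) ∧
        (M.disjointSum N h).eRk ((M.disjointSum N h).E \ A) = ((4 : ℕ) : ℕ∞)}.ncard ≤
      5 * {A : Set α | A ⊆ (M.disjointSum N h).E ∧ ((4 : ℕ) : ℕ∞) < (M.disjointSum N h).eRk A ∧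
        (M.disjointSum N h).eRk A < ((7 : ℕ) : ℕ∞)}.ncard := by
    calc 14 * {A : Set α | A ⊆ (M.disjointSum N h).E ∧ (M.disjointSum N h).eRk A = ((7 : ℕ) : ℕ∞) ∧
          (M.disjointSum N h).eRk ((M.disjointSum N h).E \ A) = ((4 : ℕ) : ℕ∞)}.ncard
        ≤ 14 * ((profileSet M r 4).ncard + (s + 1) * (profileSet M r 3).ncard) := Nat.mul_le_mul_left _ hU
      _ ≤ 14 * ((s + 1) * ((profileSet M r 4).ncard + (profileSet M r 3).ncard)) := by
          apply Nat.mul_le_mul_left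
          nlinarith
      _ ≤ 14 * ((s + 1) * (rankSet M r).ncard) :=
          Nat.mul_le_mul_left _ (Nat.mul_le_mul_left _ hsum)
      _ = (14 * (s + 1)) * (rankSet M r).ncard := by ring
      _ ≤ (5 * (Nat.choose (s + 1) (s - 2) + Nat.choose (s + 1) (s - 1))) * (rankSet M r).ncard :=
          Nat.mul_le_mul_right _ hb
      _ = 5 * ((rankSet M r).ncard * (Nat.choose (s + 1) (s - 2) + Nat.choose (s + 1) (s - 1))) := by ring
      _ ≤ 5 * {A : Set α | A ⊆ (M.disjointSum N h).E ∧ ((4 : ℕ) : ℕ∞) < (M.disjointSum N h).eRk A ∧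
            (M.disjointSum N h).eRk A < ((7 : ℕ) : ℕ∞)}.ncard := Nat.mul_le_mul_left _ hY
  rw [phiK_seven_four]
  have hkey' : (14 : ℚ) * (({A : Set α | A ⊆ (M.disjointSum N h).E ∧
      (M.disjointSum N h).eRk A = ((7 : ℕ) : ℕ∞) ∧
      (M.disjointSum N h).eRk ((M.disjointSum N h).E \ A) = ((4 : ℕ) : ℕ∞)}.ncard : ℕ) : ℚ) ≤
      5 * (({A : Set α | A ⊆ (M.disjointSum N h).E ∧ ((4 : ℕ) : ℕ∞) < (M.disjointSum N h).eRk A ∧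
        (M.disjointSum N h).eRk A < ((7 : ℕ) : ℕ∞)}.ncard : ℕ) : ℚ) := by
    exact_mod_cast hkey
  exact consumer_arith_seven_four_large hkey'

/-- **EVERY CIRCUIT SUMMAND AT `(7, 4)`**: `Φ(7, 4) · #U(M ⊕ N; 7, 4) ≤ #Y(M ⊕ N; 7, 4)` for every finite `M`
of rank `r` and every finite `N` whose ground set is a circuit of `s + 1 ≥ 3` elements with `r + s = 7`. -/
theorem c025_seven_four_disjointSum_circuit (M N : Matroid α) [M.Finite] [N.Finite]
    (h : Disjoint M.E N.E) {r s : ℕ} (hrs : r + s = 7) (hs : 2 ≤ s) (hM : M.eRank = r)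
    (hN : N.IsCircuit N.E) (hNs : N.E.ncard = s + 1) :
    phiK 7 4 * ({A : Set α | A ⊆ (M.disjointSum N h).E ∧ (M.disjointSum N h).eRk A = ((7 : ℕ) : ℕ∞) ∧
        (M.disjointSum N h).eRk ((M.disjointSum N h).E \ A) = ((4 : ℕ) : ℕ∞)}.ncard : ℚ) ≤
      ({A : Set α | A ⊆ (M.disjointSum N h).E ∧ ((4 : ℕ) : ℕ∞) < (M.disjointSum N h).eRk A ∧
        (M.disjointSum N h).eRk A < ((7 : ℕ) : ℕ∞)}.ncard : ℚ) := by
  rcases Nat.lt_or_ge s 4 with hs4 | hs4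
  · rcases Nat.lt_or_ge s 3 with hs3 | hs3
    · have hs2 : s = 2 := by omega
      subst hs2
      have hr : r = 5 := by omega
      subst hr
      exact c025_seven_four_disjointSum_triangle M N h hM hN hNs
    · have hs3' : s = 3 := by omega
      subst hs3'
      have hr : r = 4 := by omega
      subst hr
      exact c025_seven_four_disjointSum_circuit_four M N h hM hN hNs
  · exact c025_seven_four_disjointSum_circuit_large M N h hrs hs4 hM hN hNs

end S1

end PercRepro
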